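import Summits.QuantumAdvantage.QuantumAdvantage.Theorems.CubicForrelationNearExactIsExactTwentyPairing

/-!
# Crux `CubicForrelation.NearExactIsExact` (stmt-QuantumAdvantage-14043) — n = 20, TWO-SIDED: at level `≥ 8` (`W_g ∈ 256ℤ`) the boundary
  value forces exactness: `Φ ≥ 127/128 ⇒ Φ = 1`

Certificate seat `b2b-cforr-cert` (gen 6).  HONEST FRAMING: a theorem about cubic Boolean pairs on 20 bits (finite slice `n = 20` of the crux) —
the level-8 boundary configuration of the certified bound `θ₂₀ ≤ 127/128` is excluded two-sidedly (level `≥ 9` by the landed tower); NOT summit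
progress.

`tl20_levelEight_ge`: for cubic `f, g : 𝔽₂²⁰ → 𝔽₂` with `W_g = 256·u'` and `Φ(f,g) ≥ 127/128`: `Φ(f,g) = 1`.  Proof.  If every `u'` is even:
level 9 has capacity `≤ 63/64` unless `W_g ∈ 1024ℤ`, where `g` is bent (`Φ = 1` or `≤ 31/32`) or the capacity is `≤ 63/64` (`tw_step`,
`tw_top`, `tw_bent_end`).  Otherwise `p = [u' odd]` is quadratic (tower), the budget `Σ(u − 8s)² = 4Σ(u' − 4s)² = 2²⁷(1−Φ) ≤ 2²⁰` (`u = 2u'`)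
pays `≥ 1` per odd point and `RM(2,20)` gives `#P ≥ 2¹⁸`: `P = {u' odd}` is an 18-FLAT `x₁ ⊕ V₀`, `u' = 4s` off `P`, `e := u' − 4s = ±1` on `P`,
`Φ = 127/128`.  Two directions `t₁, t₂` with `t₁, t₂, t₁⊕t₂ ∉ V₀` (`fl1_dirs2`); the general 5- and 6-flat sums (`8 ∣ Σ₅ u`, `16 ∣ Σ₆ u` on 20
bits; Ax `8Σ(−1)^f ∈ 32ℤ`) localise (`sp_loc2`) and give (H3)/(H4); the engine `fl1_flat_l1` yields `Σ|(e1_P)^| ≤ 2²¹`, while the pairing needs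
`Σ_y (−1)^g (2e1_P)^(y) = 2²⁶` (`tp20_pairing`).

References: J. Ax (1964) / R. J. McEliece (1972); MacWilliams–Sloane (1977) Ch. 13–15; X.-D. Hou (1998); R. O'Donnell (2014) §3.3.  Everything
below is proved from Mathlib and the tree; axioms are the standard three.
-/

set_option linter.dupNamespace false -- D-0017: single-problem summit ⇒ `QuantumAdvantage.QuantumAdvantage` by design

noncomputable section

namespace Summit.QuantumAdvantage.QuantumAdvantage.Theorems.CubicForrelation.NearExactIsExact

open Finset
open Literature.Computability.QuantumComplexity
open Literature.Computability.QuantumComplexity.BuzetChailloux (bxor zeroVec bxor_bxor_cancel_left bxor_zeroVec zeroVec_bxor bxor_comm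
  bxor_self)
open Literature.Computability.QuantumComplexity.DerivativeWalsh (W)

/-- **Level `≥ 8` on 20 bits: `Φ ≥ 127/128 ⇒ Φ = 1`.**  For cubic `f, g : 𝔽₂²⁰ → 𝔽₂` with `W_g = 256·u'` and `Φ(f,g) ≥ 127/128` the pair is
exact.  Finite-slice statement; NOT summit progress. [this work] -/
theorem tl20_levelEight_ge (f g : (Fin (10 + 10) → Bool) → Bool) (hf : IsDegLeFun 3 f) (hg : IsDegLeFun 3 g)
    (u' : (Fin (10 + 10) → Bool) → ℤ) (hu' : ∀ x, W (fun y => signOf (g y)) x = (2 : ℝ) ^ 8 * (u' x : ℝ))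
    (hΦ : (127 / 128 : ℝ) ≤ forrelation f g) : forrelation f g = 1 := by
  classical
  -- level ≥ 9: the landed tower
  by_cases hall : ∀ x, ¬ Odd (u' x)
  · have hu₉ := tw_level_up g u' hu' hall
    rcases tw_step (j := 9) (d := 3) g (fun x => u' x / 2) hg (by norm_num) hu₉ (by intro k hk hkn; omega) with hcap | ⟨u₁₀, hu₁₀⟩
    · exfalso; have := tw_forrelation_le_of_cap f g hcap; norm_num at this; linarith
    rcases tw_top (d := 5) g u₁₀ hg hu₁₀ (by intro k hk hkn; omega) with hbent | hcap
    · rcases tw_bent_end (by norm_num) f g hf hg hbent with h | h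
      · exact h
      · exfalso; norm_num at h; linarith
    · exfalso; have := tw_forrelation_le_of_cap f g hcap; norm_num at this; linarith
  exfalso
  push Not at hall
  obtain ⟨x₁, hx₁⟩ := hall
  -- `u = 2u'` at the Ax level `7`
  set u : (Fin (10 + 10) → Bool) → ℤ := fun x => 2 * u' x with hudef
  have hu : ∀ x, W (fun y => signOf (g y)) x = (2 : ℝ) ^ 7 * (u x : ℝ) := by
    intro x; rw [hu' x]; simp only [u]; push_cast; ring
  -- the parity of `u'` is quadratic
  have hp : IsDegLeFun 2 (fun x => decide (Odd (u' x))) :=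
    stub_walshTower stub_axParity (10 + 10) 8 2 g u' hg hu' (by intro k hk hkn; omega)
  have hp' : IsDegLeFun (1 + 1) (fun x => decide (Odd (u' x))) := hp
  -- budget `Σ (u' − 4s)² ≤ 2¹⁸`
  have hbud := tp20_budget f g u hu
  have hB : (∑ x, (u' x - 4 * sZ (f x)) ^ 2 : ℤ) ≤ 2 ^ 18 := by
    have h4 : ∀ x, (u x - 8 * sZ (f x)) ^ 2 = 4 * (u' x - 4 * sZ (f x)) ^ 2 := fun x => by simp only [u]; ring
    have h' : ((∑ x, (u x - 8 * sZ (f x)) ^ 2 : ℤ) : ℝ) ≤ 2 ^ 20 := by rw [hbud]; nlinarith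
    have h'' : (∑ x, (u x - 8 * sZ (f x)) ^ 2 : ℤ) ≤ 2 ^ 20 := by exact_mod_cast h'
    rw [sum_congr rfl fun x _ => h4 x, ← mul_sum] at h''
    linarith
  -- RM: `#P ≥ 2¹⁸`
  set P := univ.filter (fun x : Fin (10 + 10) → Bool => Odd (u' x)) with hPdef
  have hmemP : ∀ x, x ∈ P ↔ Odd (u' x) := fun x => by simp [hPdef]
  have hfilt : (univ.filter fun x : Fin (10 + 10) → Bool => decide (Odd (u' x)) = true) = P := filter_congr fun x _ => by simp
  have hRM := bb_rmWeight_holds (10 + 10) 2 (fun x => decide (Odd (u' x))) hp ⟨x₁, by simpa using hx₁⟩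
  rw [hfilt] at hRM
  have hPge : 2 ^ 18 ≤ #P := by
    have h2 : (2 : ℕ) ^ (10 + 10) = 2 ^ 2 * 2 ^ 18 := by norm_num
    rw [h2] at hRM
    exact Nat.le_of_mul_le_mul_left hRM (by positivity)
  -- everything is tight
  have hsumP : (∑ x, (if Odd (u' x) then 1 else 0 : ℤ)) = #P := by rw [sum_boole]
  have hnonneg : ∀ x, 0 ≤ (u' x - 4 * sZ (f x)) ^ 2 - (if Odd (u' x) then 1 else 0 : ℤ) := by
    intro x
    by_cases h : Odd (u' x)
    · rw [if_pos h]; have := ft_sq_ge_one (tp_sZ_cases (f x)) h; linarith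
    · rw [if_neg h]; have := sq_nonneg (u' x - 4 * sZ (f x)); linarith
  have hsum0 : ∑ x, ((u' x - 4 * sZ (f x)) ^ 2 - (if Odd (u' x) then 1 else 0 : ℤ)) = 0 := by
    refine le_antisymm ?_ (sum_nonneg fun x _ => hnonneg x)
    rw [sum_sub_distrib, hsumP]
    have : (2 : ℤ) ^ 18 ≤ #P := by exact_mod_cast hPge
    linarith
  have hzero' : ∀ x, (u' x - 4 * sZ (f x)) ^ 2 - (if Odd (u' x) then 1 else 0 : ℤ) = 0 :=
    fun x => (sum_eq_zero_iff_of_nonneg fun y _ => hnonneg y).1 hsum0 x (mem_univ x)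
  have hoff : ∀ x, ¬ Odd (u' x) → u' x - 4 * sZ (f x) = 0 := by
    intro x hx
    have h := hzero' x
    rw [if_neg hx, sub_zero] at h
    exact (pow_eq_zero_iff two_ne_zero).1 h
  have hon : ∀ x, Odd (u' x) → u' x - 4 * sZ (f x) = 1 ∨ u' x - 4 * sZ (f x) = -1 := by
    intro x hx
    have h := hzero' x
    rw [if_pos hx] at h
    have h1 : (u' x - 4 * sZ (f x)) * (u' x - 4 * sZ (f x)) = 1 := by rw [← pow_two]; linarith
    exact mul_self_eq_one_iff.1 h1
  have hPcard : #P = 2 ^ 18 := by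
    have hle : (#P : ℤ) ≤ 2 ^ 18 := by
      rw [← hsumP]
      exact le_trans (sum_le_sum fun x _ => by have := hnonneg x; linarith) hB
    have hle' : #P ≤ 2 ^ 18 := by exact_mod_cast hle
    omega
  have hΦeq : forrelation f g = 127 / 128 := by
    have hT : (∑ x, (u x - 8 * sZ (f x)) ^ 2 : ℤ) = 2 ^ 20 := by
      have h4 : ∀ x, (u x - 8 * sZ (f x)) ^ 2 = 4 * ((u' x - 4 * sZ (f x)) ^ 2 - (if Odd (u' x) then 1 else 0 : ℤ)) +
          4 * (if Odd (u' x) then 1 else 0 : ℤ) := fun x => by simp only [u]; ring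
      rw [sum_congr rfl fun x _ => h4 x, sum_add_distrib, ← mul_sum, ← mul_sum, hsum0, hsumP, hPcard]
      norm_num
    have h : ((∑ x, (u x - 8 * sZ (f x)) ^ 2 : ℤ) : ℝ) = 2 ^ 20 := by exact_mod_cast hT
    rw [hbud] at h
    linarith
  -- `P` is an 18-flat
  have hmw := mw_flat_of_minweight 1 (fun x => decide (Odd (u' x))) hp' (by rw [hfilt, hPcard]; norm_num)
  rw [hfilt] at hmw
  obtain ⟨h0, hadd, hcardV, hcoset⟩ := hmw
  set V₀ := univ.filter (fun a : Fin (10 + 10) → Bool => ∀ x, decide (Odd (u' (bxor x a))) = decide (Odd (u' x))) with hV₀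
  have hS : P = V₀.image (bxor x₁) := hcoset x₁ (by simpa using hx₁)
  rw [hPcard] at hcardV
  -- two transversal directions
  obtain ⟨t₁, -, t₂, -, ht₁, ht₂, -, ht₂₁⟩ := fl1_dirs2 univ V₀ (by
    rw [hcardV, card_univ, Fintype.card_fun, Fintype.card_bool, Fintype.card_fin]; norm_num)
  -- the sign pattern and the vanishing of the residual off `P`
  set e : (Fin (10 + 10) → Bool) → ℤ := fun x => u' x - 4 * sZ (f x) with hedef
  have he : ∀ x ∈ P, e x = 1 ∨ e x = -1 := fun x hx => hon x ((hmemP x).1 hx)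
  have hF0 : ∀ y, y ∉ P → u y - 8 * sZ (f y) = 0 := by
    intro y hy
    have := hoff y (fun h => hy ((hmemP y).2 h))
    simp only [u]; linarith
  have hFe : ∀ y, u y - 8 * sZ (f y) = 2 * e y := fun y => by simp only [u, e]; ring
  have hPV : ∀ x, x ∈ P → ∀ a ∈ V₀, bxor x a ∈ P := fun x hx a ha => fl1_coset_vadd hadd hS hx ha
  have hz : ∀ p ∈ P, ∀ w, w ∉ V₀ → u (bxor p w) - 8 * sZ (f (bxor p w)) = 0 :=
    fun p hp w hw => hF0 _ (fl1_coset_out h0 hadd hS hp hw)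
  -- localisation by the two directions
  have hloc : ∀ {k : ℕ} (x : Fin (10 + 10) → Bool) (a : Fin k → Fin (10 + 10) → Bool),
      (∀ ε : Fin k → Bool, (fun j => x j ^^ decide (Odd #(univ.filter fun i => ε i && a i j))) ∈ P) →
      ∑ ε : Fin (k + 2) → Bool, (u (fun j => x j ^^ decide (Odd #(univ.filter fun i =>
          ε i && (Matrix.vecCons t₁ (Matrix.vecCons t₂ a) : Fin (k + 2) → Fin (10 + 10) → Bool) i j))) -
        8 * sZ (f (fun j => x j ^^ decide (Odd #(univ.filter fun i =>
          ε i && (Matrix.vecCons t₁ (Matrix.vecCons t₂ a) : Fin (k + 2) → Fin (10 + 10) → Bool) i j))))) =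
      ∑ ε : Fin k → Bool, 2 * e (fun j => x j ^^ decide (Odd #(univ.filter fun i => ε i && a i j))) := by
    intro k x a hin
    have key := sp_loc2 (fun y => u y - 8 * sZ (f y)) x t₁ t₂ a (fun ε => hz _ (hin ε) t₁ ht₁)
      (fun ε => hz _ (hin ε) t₂ ht₂) (fun ε => by rw [iw_bxor_assoc]; exact hz _ (hin ε) _ ht₂₁)
    beta_reduce at key
    rw [key]
    exact sum_congr rfl fun ε _ => hFe _
  -- (H3) and (H4)
  have H3 : ∀ x ∈ P, ∀ a b c : Fin (10 + 10) → Bool, a ∈ V₀ → b ∈ V₀ → c ∈ V₀ →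
      (4 : ℤ) ∣ ∑ ε : Fin 3 → Bool, e (fun j => x j ^^ decide (Odd #(univ.filter fun i =>
        ε i && (![a, b, c] : Fin 3 → Fin (10 + 10) → Bool) i j))) := by
    intro x hx a b c ha hb hc
    have hin : ∀ ε : Fin 3 → Bool, (fun j => x j ^^ decide (Odd #(univ.filter fun i =>
        ε i && (![a, b, c] : Fin 3 → Fin (10 + 10) → Bool) i j))) ∈ P :=
      fun ε => fr_mem_flatPt3 V₀ h0 (· ∈ P) hPV hx ![a, b, c] (fun i => by fin_cases i <;> assumption) ε
    have h8 := fs_flat_sum_dvd (e := 3) g u hg hu x ![t₁, t₂, a, b, c] (by norm_num)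
    obtain ⟨zf, hzf⟩ := sl_sum_sZ_flat f hf x ![t₁, t₂, a, b, c]
    have hzf' : ∑ ε : Fin 5 → Bool, 8 * sZ (f (fun j => x j ^^ decide (Odd #(univ.filter fun i =>
          ε i && (![t₁, t₂, a, b, c] : Fin 5 → Fin (10 + 10) → Bool) i j)))) = 8 * (4 * zf) := by
      rw [← mul_sum, hzf]; norm_num
    have h8n : (8 : ℤ) ∣ ∑ ε : Fin 5 → Bool, u (fun j => x j ^^ decide (Odd #(univ.filter fun i =>
          ε i && (![t₁, t₂, a, b, c] : Fin 5 → Fin (10 + 10) → Bool) i j))) := by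
      have e8 : (2 : ℤ) ^ 3 = 8 := by norm_num
      rw [e8] at h8; exact h8
    have h8' : (8 : ℤ) ∣ ∑ ε : Fin 5 → Bool, (u (fun j => x j ^^ decide (Odd #(univ.filter fun i =>
          ε i && (![t₁, t₂, a, b, c] : Fin 5 → Fin (10 + 10) → Bool) i j))) -
        8 * sZ (f (fun j => x j ^^ decide (Odd #(univ.filter fun i =>
          ε i && (![t₁, t₂, a, b, c] : Fin 5 → Fin (10 + 10) → Bool) i j))))) := by
      rw [sum_sub_distrib, hzf']
      exact dvd_sub h8n (Dvd.intro _ rfl)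
    rw [hloc x ![a, b, c] hin, ← mul_sum] at h8'
    obtain ⟨k8, hk8⟩ := h8'
    exact ⟨k8, by linarith⟩
  have H4 : ∀ x ∈ P, ∀ a₀ a₁ a₂ a₃ : Fin (10 + 10) → Bool, a₀ ∈ V₀ → a₁ ∈ V₀ → a₂ ∈ V₀ → a₃ ∈ V₀ →
      (8 : ℤ) ∣ ∑ ε : Fin 4 → Bool, e (fun j => x j ^^ decide (Odd #(univ.filter fun i =>
        ε i && (![a₀, a₁, a₂, a₃] : Fin 4 → Fin (10 + 10) → Bool) i j))) := by
    intro x hx a₀ a₁ a₂ a₃ ha₀ ha₁ ha₂ ha₃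
    have hin : ∀ ε : Fin 4 → Bool, (fun j => x j ^^ decide (Odd #(univ.filter fun i =>
        ε i && (![a₀, a₁, a₂, a₃] : Fin 4 → Fin (10 + 10) → Bool) i j))) ∈ P :=
      fun ε => fr_mem_flatPt4 V₀ h0 (· ∈ P) hPV hx ![a₀, a₁, a₂, a₃] (fun i => by fin_cases i <;> assumption) ε
    have h16 := fs_flat_sum_dvd (e := 4) g u hg hu x ![t₁, t₂, a₀, a₁, a₂, a₃] (by norm_num)
    obtain ⟨zf, hzf⟩ := sl_sum_sZ_flat f hf x ![t₁, t₂, a₀, a₁, a₂, a₃]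
    have hzf' : ∑ ε : Fin 6 → Bool, 8 * sZ (f (fun j => x j ^^ decide (Odd #(univ.filter fun i =>
          ε i && (![t₁, t₂, a₀, a₁, a₂, a₃] : Fin 6 → Fin (10 + 10) → Bool) i j)))) = 16 * (2 * zf) := by
      rw [← mul_sum, hzf]; norm_num; ring
    have h16n : (16 : ℤ) ∣ ∑ ε : Fin 6 → Bool, u (fun j => x j ^^ decide (Odd #(univ.filter fun i =>
          ε i && (![t₁, t₂, a₀, a₁, a₂, a₃] : Fin 6 → Fin (10 + 10) → Bool) i j))) := by
      have e16 : (2 : ℤ) ^ 4 = 16 := by norm_num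
      rw [e16] at h16; exact h16
    have h16' : (16 : ℤ) ∣ ∑ ε : Fin 6 → Bool, (u (fun j => x j ^^ decide (Odd #(univ.filter fun i =>
          ε i && (![t₁, t₂, a₀, a₁, a₂, a₃] : Fin 6 → Fin (10 + 10) → Bool) i j))) -
        8 * sZ (f (fun j => x j ^^ decide (Odd #(univ.filter fun i =>
          ε i && (![t₁, t₂, a₀, a₁, a₂, a₃] : Fin 6 → Fin (10 + 10) → Bool) i j))))) := by
      rw [sum_sub_distrib, hzf']
      exact dvd_sub h16n (Dvd.intro _ rfl)
    rw [hloc x ![a₀, a₁, a₂, a₃] hin, ← mul_sum] at h16'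
    obtain ⟨k16, hk16⟩ := h16'
    exact ⟨k16, by linarith⟩
  -- the engine and the pairing
  have hE := fl1_flat_l1 V₀ P x₁ h0 hadd hS e he H3 H4
  set A : (Fin (10 + 10) → Bool) → ℝ := fun x => if x ∈ P then (e x : ℝ) else 0 with hA
  have hAτ : (fun x => (u x : ℝ) - 8 * signOf (f x)) = fun x => 2 * A x := by
    funext x
    have h2 : (u x : ℝ) - 8 * signOf (f x) = (((u x - 8 * sZ (f x) : ℤ)) : ℝ) := by push_cast; rw [tp_sZ_cast]
    rw [h2]
    by_cases hx : x ∈ P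
    · simp only [A, if_pos hx]; rw [hFe x]; push_cast; ring
    · simp only [A, if_neg hx]; rw [hF0 x hx]; norm_num
  have hpair := tp20_pairing f g u hu
  rw [hΦeq, hAτ] at hpair
  have hpair' : ∑ y, signOf (g y) * W A y = 2 ^ 25 := by
    have e2 : ∀ y, signOf (g y) * W (fun x => 2 * A x) y = 2 * (signOf (g y) * W A y) := fun y => by
      rw [fl1_W_smul]; ring
    have h33 : (2 : ℝ) ^ 33 * (1 - 127 / 128) = 2 * 2 ^ 25 := by norm_num
    rw [sum_congr rfl fun y _ => e2 y, ← mul_sum, h33] at hpair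
    linarith
  have hge : (2 : ℝ) ^ 25 ≤ ∑ y, |W A y| := by rw [← hpair']; exact fl1_pairing_le_l1 g (W A)
  have hsq : ((2 : ℝ) ^ 25) ^ 2 ≤ (∑ y, |W A y|) ^ 2 := pow_le_pow_left₀ (by positivity) hge 2
  norm_num at hE hsq
  linarith

end Summit.QuantumAdvantage.QuantumAdvantage.Theorems.CubicForrelation.NearExactIsExact

end
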